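import Literature.NumberTheory.DiophantineGeometry.PlaneCurveBezoutWeak
import Literature.NumberTheory.DiophantineGeometry.PlaneSectionCountingProofs
import HarnessLib

/-!
# A monic plane model of a polynomial in two variables (shearing the coordinates)

Library file (theorems only). Let `K` be a field and `g ∈ K[x₀, x₁]` (`MvPolynomial (Fin 2) K`) of
total degree `e`. After the shear `x₀ ↦ x₀ + c x₁` the coefficient of `x₁^e` becomes
`u(c) = ∑_{a+b=e} g_{a,b} c^a` (`coeff_single_one_shear`), a nonzero polynomial function of `c` of
degree `≤ e` when `g ≠ 0`; so if `K` has more than `e` elements some `c ∈ K` makes it nonzero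
(`exists_coeff_shear_ne_zero`). Dividing by `u` and reading the result in `K[X][Y]` (`Y = x₁`,
Mathlib's `Polynomial.Bivariate.equivMvPolynomial`) gives a polynomial `Φ` which is

* monic of degree `e` in `Y` with `deg_X (coeff of Yⁱ) + i ≤ e` (`monic_model`, `natDegree_model`,
  `natDegree_coeff_model_add_le`) — the shape required by the function-field treatment of plane
  curves (`PlaneCurveFunctionFieldProofs`, `PlaneCurvePointCountProofs`);
* with `Φ(a, b) = u⁻¹ g(a + c b, b)` (`evalEval_model`), so that `Φ` and `g` have the same number of
  zeros in `K²` (`card_zeros_model`);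
* absolutely irreducible when `g` is (`irreducible_map_model`: the construction commutes with base
  change and consists of algebra automorphisms and a unit factor).

This is the (standard) normalisation by a linear change of coordinates used before applying Weil's
estimate to the plane sections `f_L` in Cafure–Matera 2006, §5 (there implicit: "`f_L` is
univocally defined up to an `𝔽_q`-definable affine linear change of coordinates").

## References

* A. Cafure, G. Matera, Finite Fields Appl. 12 (2006) 155–185, §4 (before eq. (10)). [CafureMatera2006]
-/

noncomputable section

open MvPolynomial Polynomial.Bivariate

namespace Literature.NumberTheory.DiophantineGeometry

variable {K : Type*} [Field K]

/-- The substitution `x₀ ↦ x₀ + c x₁`, `x₁ ↦ x₁` defining the shear, over the field `F`. -/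
local notation "sv(" F ", " c ")" =>
  (![MvPolynomial.X 0 + MvPolynomial.C c * MvPolynomial.X 1, MvPolynomial.X 1] :
    Fin 2 → MvPolynomial (Fin 2) F)

/-! ### The shear `x₀ ↦ x₀ + c x₁` -/

/-- Evaluating the sheared polynomial: `(τ_c g)(x₀, x₁) = g(x₀ + c x₁, x₁)`. [folklore] -/
theorem eval_shear (g : MvPolynomial (Fin 2) K) (c : K) (x : Fin 2 → K) :
    MvPolynomial.eval x (MvPolynomial.aeval sv(K, c) g) =
      MvPolynomial.eval ![x 0 + c * x 1, x 1] g := by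
  have h := comp_aeval_apply (f := sv(K, c)) (MvPolynomial.aeval (R := K) x) g
  have hf : (fun i ↦ MvPolynomial.aeval (R := K) x (sv(K, c) i)) = ![x 0 + c * x 1, x 1] := by
    funext i
    fin_cases i <;> simp
  rw [hf] at h
  exact h

/-- The shear does not increase the total degree. [folklore] -/
theorem totalDegree_shear_le (g : MvPolynomial (Fin 2) K) (c : K) :
    (MvPolynomial.aeval sv(K, c) g).totalDegree ≤ g.totalDegree := by
  refine totalDegree_aeval_le_of_le_one _ (fun i ↦ ?_) g
  fin_cases i
  · simp only [Fin.zero_eta, Fin.isValue, Matrix.cons_val_zero]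
    refine (totalDegree_add _ _).trans (max_le (totalDegree_X (R := K) _).le ?_)
    exact (totalDegree_mul _ _).trans (by rw [totalDegree_C, zero_add]; exact (totalDegree_X (R := K) _).le)
  · simp only [Fin.mk_one, Fin.isValue, Matrix.cons_val_one, Matrix.cons_val_zero]
    exact (totalDegree_X (R := K) _).le

/-- Base change commutes with the shear. [folklore] -/
theorem map_shear {L : Type*} [CommRing L] (σ : K →+* L) (g : MvPolynomial (Fin 2) K) (c : K) :
    MvPolynomial.map σ (MvPolynomial.aeval sv(K, c) g) =
      MvPolynomial.aeval sv(L, σ c) (MvPolynomial.map σ g) := by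
  have h1 : (MvPolynomial.map σ).comp (algebraMap K (MvPolynomial (Fin 2) K)) =
      (C : L →+* MvPolynomial (Fin 2) L).comp σ := by
    ext r
    simp [MvPolynomial.algebraMap_eq]
  have h2 : (fun i ↦ MvPolynomial.map σ (sv(K, c) i)) = sv(L, σ c) := by
    funext i
    fin_cases i <;> simp [map_X, map_C]
  rw [map_aeval, h1, h2, aeval_def, MvPolynomial.algebraMap_eq, coe_eval₂Hom, eval₂_map]

/-- The coefficient of `x₁^e` in `(x₀ + c x₁)^a x₁^b` is `c^a` if `a + b = e` and `0` otherwise.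
[folklore] -/
theorem coeff_single_one_X_add_pow_mul (c : K) (a b e : ℕ) :
    coeff (Finsupp.single 1 e) ((X 0 + C c * X 1) ^ a * X 1 ^ b : MvPolynomial (Fin 2) K) =
      if a + b = e then c ^ a else 0 := by
  rw [add_pow, Finset.sum_mul, coeff_sum]
  have hterm : ∀ k ∈ Finset.range (a + 1),
      coeff (Finsupp.single 1 e)
        ((X 0) ^ k * (C c * X 1) ^ (a - k) * (a.choose k : MvPolynomial (Fin 2) K) * X 1 ^ b) =
      if k = 0 ∧ a + b = e then c ^ a else 0 := by
    intro k hk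
    rw [Finset.mem_range] at hk
    have hmon : (X 0) ^ k * (C c * X 1) ^ (a - k) * (a.choose k : MvPolynomial (Fin 2) K) * X 1 ^ b =
        monomial (Finsupp.single 0 k + Finsupp.single 1 (a - k + b)) (c ^ (a - k) * a.choose k) := by
      rw [mul_pow, ← map_pow, X_pow_eq_monomial, X_pow_eq_monomial, X_pow_eq_monomial,
        ← map_natCast C, C_mul_monomial, C_apply, monomial_mul, monomial_mul, monomial_mul]
      congr 1
      · rw [add_zero, add_assoc, ← Finsupp.single_add]
      · ring
    rw [hmon, coeff_monomial]
    by_cases h : k = 0 ∧ a + b = e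
    · obtain ⟨rfl, rfl⟩ := h
      rw [if_pos, if_pos ⟨rfl, rfl⟩, Nat.sub_zero, Nat.choose_zero_right, Nat.cast_one, mul_one]
      rw [show Finsupp.single (1 : Fin 2) (a + b) = Finsupp.single 0 0 + Finsupp.single 1 (a + b) by
        rw [Finsupp.single_zero, zero_add], Dioph.single_add_single_inj]
      exact ⟨rfl, by omega⟩
    · rw [if_neg h, if_neg]
      rw [show Finsupp.single (1 : Fin 2) e = Finsupp.single 0 0 + Finsupp.single 1 e by
        rw [Finsupp.single_zero, zero_add], Dioph.single_add_single_inj]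
      intro h'
      exact h ⟨h'.1, by omega⟩
  rw [Finset.sum_congr rfl hterm, Finset.sum_ite, Finset.sum_const_zero, add_zero, Finset.sum_const]
  by_cases hab : a + b = e
  · rw [if_pos hab]
    have : (Finset.range (a + 1)).filter (fun k ↦ k = 0 ∧ a + b = e) = {0} := by
      ext k
      simp only [Finset.mem_filter, Finset.mem_range, Finset.mem_singleton]
      constructor
      · rintro ⟨-, hk, -⟩; exact hk
      · rintro rfl; exact ⟨by omega, rfl, hab⟩
    rw [this, Finset.card_singleton, one_smul]
  · rw [if_neg hab]
    have : (Finset.range (a + 1)).filter (fun k ↦ k = 0 ∧ a + b = e) = ∅ := by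
      ext k
      simp only [Finset.mem_filter, Finset.mem_range, Finset.notMem_empty, iff_false, not_and]
      intro _ _ h
      exact hab h
    rw [this, Finset.card_empty, zero_smul]

/-- **The coefficient of `x₁^e` after the shear `x₀ ↦ x₀ + c x₁` is `∑_{a+b=e} g_{a,b} c^a`.**
[folklore] -/
theorem coeff_single_one_shear (g : MvPolynomial (Fin 2) K) (c : K) (e : ℕ) :
    coeff (Finsupp.single 1 e) (MvPolynomial.aeval sv(K, c) g) =
      ∑ a ∈ Finset.range (e + 1),
        coeff (Finsupp.single 0 a + Finsupp.single 1 (e - a)) g * c ^ a := by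
  classical
  -- the exponent vectors of degree `e`
  set v : ℕ → (Fin 2 →₀ ℕ) := fun a ↦ Finsupp.single 0 a + Finsupp.single 1 (e - a) with hv
  have hv_inj : ∀ a a', a ≤ e → a' ≤ e → v a = v a' → a = a' := by
    intro a a' _ _ h
    exact ((Dioph.single_add_single_inj).1 h).1
  -- monomial computation
  have hmono : ∀ s : Fin 2 →₀ ℕ, ∀ r : K,
      coeff (Finsupp.single 1 e) (MvPolynomial.aeval sv(K, c) (monomial s r)) =
        r * (if s 0 + s 1 = e then c ^ (s 0) else 0) := by
    intro s r
    rw [aeval_monomial, Finsupp.prod_fintype _ _ (fun i ↦ by simp), Fin.prod_univ_two]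
    simp only [Fin.isValue, Matrix.cons_val_zero, Matrix.cons_val_one]
    rw [MvPolynomial.algebraMap_eq, coeff_C_mul, coeff_single_one_X_add_pow_mul]
  -- expand `g` as a sum of monomials
  conv_lhs => rw [g.as_sum, map_sum, coeff_sum]
  simp_rw [hmono]
  -- each monomial of degree `e` is `v a` for exactly one `a ≤ e`
  have hstep : ∀ s ∈ g.support, coeff s g * (if s 0 + s 1 = e then c ^ (s 0) else 0) =
      ∑ a ∈ Finset.range (e + 1), if s = v a then coeff s g * c ^ a else 0 := by
    intro s _
    by_cases hs : s 0 + s 1 = e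
    · rw [if_pos hs, Finset.sum_eq_single (s 0)]
      · rw [if_pos]
        ext i; fin_cases i <;> simp [hv]; omega
      · intro a ha hne
        rw [if_neg]
        intro hsv
        apply hne
        have := DFunLike.congr_fun hsv 0
        simp [hv] at this
        exact this.symm
      · intro h
        exfalso
        apply h
        rw [Finset.mem_range]; omega
    · rw [if_neg hs, mul_zero]
      refine (Finset.sum_eq_zero fun a ha ↦ ?_).symm
      rw [if_neg]
      intro hsv
      apply hs
      rw [Finset.mem_range] at ha
      have h0 := DFunLike.congr_fun hsv 0
      have h1 := DFunLike.congr_fun hsv 1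
      simp [hv] at h0 h1
      omega
  rw [Finset.sum_congr rfl hstep, Finset.sum_comm]
  refine Finset.sum_congr rfl fun a ha ↦ ?_
  rw [Finset.sum_ite_eq' g.support (v a) (fun s ↦ coeff s g * c ^ a)]
  by_cases hmem : v a ∈ g.support
  · rw [if_pos hmem]
  · rw [if_neg hmem, notMem_support_iff.1 hmem, zero_mul]

/-- **A good shear exists over a field with more than `deg g` elements**: if `g ≠ 0` has total
degree `e < #K` then for some `c ∈ K` the coefficient of `x₁^e` in `g(x₀ + c x₁, x₁)` is nonzero (the
polynomial `∑_{a+b=e} g_{a,b} T^a` is nonzero of degree `≤ e`, so it has a non-root).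
[folklore] -/
theorem exists_coeff_shear_ne_zero [Fintype K] {g : MvPolynomial (Fin 2) K} (hg0 : g ≠ 0)
    (hq : g.totalDegree < Fintype.card K) :
    ∃ c : K, coeff (Finsupp.single 1 g.totalDegree) (MvPolynomial.aeval sv(K, c) g) ≠ 0 := by
  classical
  set e := g.totalDegree with he
  -- the univariate polynomial `u(T) = ∑_{a ≤ e} g_{a, e-a} T^a`
  set u : Polynomial K := ∑ a ∈ Finset.range (e + 1),
    Polynomial.C (coeff (Finsupp.single 0 a + Finsupp.single 1 (e - a)) g) * Polynomial.X ^ a with hu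
  have hu_eval : ∀ c : K, u.eval c =
      coeff (Finsupp.single 1 e) (MvPolynomial.aeval sv(K, c) g) := by
    intro c
    rw [coeff_single_one_shear, hu, Polynomial.eval_finsetSum]
    simp only [Polynomial.eval_mul, Polynomial.eval_C, Polynomial.eval_pow, Polynomial.eval_X]
  -- `u ≠ 0`: some monomial of `g` has degree `e`
  have hu0 : u ≠ 0 := by
    obtain ⟨s, hs, hse⟩ : ∃ s ∈ g.support, (s.sum fun _ k ↦ k) = e := by
      have hne : g.support.Nonempty := support_nonempty.2 hg0
      obtain ⟨s, hs, h⟩ := Finset.exists_mem_eq_sup g.support hne (fun s ↦ s.sum fun _ k ↦ k)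
      exact ⟨s, hs, by rw [he, totalDegree, h]⟩
    have hs01 : s 0 + s 1 = e := by
      rw [← hse, Finsupp.sum_fintype _ _ (fun _ ↦ rfl), Fin.sum_univ_two]
    have hsv : s = Finsupp.single 0 (s 0) + Finsupp.single 1 (e - s 0) := by
      ext i; fin_cases i <;> simp; omega
    intro hu0
    have hc : u.coeff (s 0) = 0 := by rw [hu0, Polynomial.coeff_zero]
    rw [hu, Polynomial.finsetSum_coeff] at hc
    simp only [Polynomial.coeff_C_mul_X_pow] at hc
    rw [Finset.sum_eq_single (s 0), if_pos rfl, ← hsv] at hc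
    · exact (mem_support_iff.1 hs) hc
    · intro a _ hne; rw [if_neg (Ne.symm hne)]
    · intro h; exfalso; apply h; rw [Finset.mem_range]; omega
  have hdeg : u.natDegree ≤ e := by
    rw [hu]
    refine Polynomial.natDegree_sum_le_of_forall_le _ _ fun a ha ↦ ?_
    rw [Finset.mem_range] at ha
    exact (Polynomial.natDegree_C_mul_X_pow_le _ _).trans (by omega)
  -- a non-root exists
  by_contra hall
  push Not at hall
  have hroots : (Finset.univ : Finset K) ⊆ u.roots.toFinset := by
    intro c _
    rw [Multiset.mem_toFinset, Polynomial.mem_roots hu0, Polynomial.IsRoot.def, hu_eval]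
    exact hall c
  have := (Finset.card_le_card hroots).trans ((Multiset.toFinset_card_le _).trans (Polynomial.card_roots' u))
  rw [Finset.card_univ] at this
  omega

/-! ### The monic model -/

section Model

variable (g : MvPolynomial (Fin 2) K) (c : K)

/-- The coefficient of `X^m Yⁱ` in the model is `u⁻¹` times the coefficient of `x₀^m x₁ⁱ` in the
sheared polynomial. [folklore] -/
theorem coeff_coeff_model (u : K) (i m : ℕ) :
    (((equivMvPolynomial K).symm (C u⁻¹ * MvPolynomial.aeval sv(K, c) g)).coeff i).coeff m =
      u⁻¹ * coeff (Finsupp.single 0 m + Finsupp.single 1 i) (MvPolynomial.aeval sv(K, c) g) := by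
  rw [← Dioph.coeff_equivMvPolynomial, AlgEquiv.apply_symm_apply, coeff_C_mul]

/-- Coefficients of the model beyond the total degree vanish: `coeff of X^m Yⁱ = 0` for
`m + i > deg g`. [folklore] -/
theorem coeff_coeff_model_eq_zero (u : K) {i m : ℕ} (h : g.totalDegree < m + i) :
    (((equivMvPolynomial K).symm (C u⁻¹ * MvPolynomial.aeval sv(K, c) g)).coeff i).coeff m
      = 0 := by
  refine Dioph.coeff_coeff_symm_eq_zero _ (lt_of_le_of_lt ?_ h)
  refine (totalDegree_mul _ _).trans ?_
  rw [totalDegree_C, zero_add]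
  exact totalDegree_shear_le g c

variable {g c}

/-- **The model is monic of degree `deg g` in `Y`** when the shear makes the coefficient `u` of
`x₁^{deg g}` nonzero. [folklore] -/
theorem natDegree_model_and_monic
    (hu : coeff (Finsupp.single 1 g.totalDegree) (MvPolynomial.aeval sv(K, c) g) ≠ 0) :
    ((equivMvPolynomial K).symm (C (coeff (Finsupp.single 1 g.totalDegree)
        (MvPolynomial.aeval sv(K, c) g))⁻¹ *
          MvPolynomial.aeval sv(K, c) g)).natDegree = g.totalDegree ∧
    ((equivMvPolynomial K).symm (C (coeff (Finsupp.single 1 g.totalDegree)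
        (MvPolynomial.aeval sv(K, c) g))⁻¹ *
          MvPolynomial.aeval sv(K, c) g)).Monic := by
  set e := g.totalDegree with he
  set u := coeff (Finsupp.single 1 e) (MvPolynomial.aeval sv(K, c) g) with hu'
  set Φ := (equivMvPolynomial K).symm (C u⁻¹ * MvPolynomial.aeval sv(K, c) g) with hΦ
  -- the coefficient of `Y^e` is `1`
  have htop : Φ.coeff e = 1 := by
    ext m
    rw [hΦ, coeff_coeff_model]
    rcases Nat.eq_zero_or_pos m with rfl | hm
    · rw [Finsupp.single_zero, zero_add, ← hu', inv_mul_cancel₀ hu, Polynomial.coeff_one_zero]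
    · rw [Polynomial.coeff_one, if_neg (by omega)]
      have := coeff_coeff_model_eq_zero g c u (i := e) (m := m) (by omega)
      rw [coeff_coeff_model] at this
      exact this
  have hle : Φ.natDegree ≤ e := by
    refine (Dioph.natDegree_symm_le _).trans ?_
    refine (totalDegree_mul _ _).trans ?_
    rw [totalDegree_C, zero_add]
    exact totalDegree_shear_le g c
  have hdeg : Φ.natDegree = e :=
    le_antisymm hle (Polynomial.le_natDegree_of_ne_zero (by rw [htop]; exact one_ne_zero))
  refine ⟨hdeg, ?_⟩
  rw [Polynomial.Monic, Polynomial.leadingCoeff, hdeg, htop]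

/-- **The coefficients of the model satisfy `deg_X (coeff of Yⁱ) + i ≤ deg g`** (for `i < deg g`).
[folklore] -/
theorem natDegree_coeff_model_add_le (u : K) {i : ℕ} (hi : i < g.totalDegree) :
    (((equivMvPolynomial K).symm (C u⁻¹ * MvPolynomial.aeval sv(K, c) g)).coeff i).natDegree
      + i ≤ g.totalDegree := by
  have h : (((equivMvPolynomial K).symm
      (C u⁻¹ * MvPolynomial.aeval sv(K, c) g)).coeff i).natDegree ≤ g.totalDegree - i := by
    rw [Polynomial.natDegree_le_iff_coeff_eq_zero]
    intro m hm
    exact coeff_coeff_model_eq_zero g c u (by omega)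
  omega

/-- **Evaluating the model**: `Φ(a, b) = u⁻¹ · g(a + c b, b)`. [folklore] -/
theorem evalEval_model (u a b : K) :
    ((equivMvPolynomial K).symm (C u⁻¹ * MvPolynomial.aeval sv(K, c) g)).evalEval a b =
      u⁻¹ * MvPolynomial.eval ![a + c * b, b] g := by
  rw [← Dioph.eval_equivMvPolynomial, AlgEquiv.apply_symm_apply, map_mul, eval_C, eval_shear]
  simp

/-- **The model has as many zeros in `K²` as `g`** (for `u ≠ 0`): `(a, b) ↦ (a + cb, b)` is a
bijection of `K²`. [folklore] -/
theorem card_zeros_model [Fintype K] [DecidableEq K] {u : K} (hu : u ≠ 0) :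
    ((Finset.univ : Finset (K × K)).filter fun z ↦
      ((equivMvPolynomial K).symm (C u⁻¹ * MvPolynomial.aeval sv(K, c) g)).evalEval
        z.1 z.2 = 0).card = rationalPointCount g := by
  classical
  unfold rationalPointCount
  refine Finset.card_bij (fun z _ ↦ ![z.1 + c * z.2, z.2]) (fun z hz ↦ ?_) (fun z₁ _ z₂ _ h ↦ ?_)
    (fun x hx ↦ ?_)
  · rw [Finset.mem_filter] at hz ⊢
    rw [evalEval_model, mul_eq_zero, inv_eq_zero] at hz
    exact ⟨Finset.mem_univ _, hz.2.resolve_left hu⟩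
  · have h0 := congr_fun h 0
    have h1 := congr_fun h 1
    simp only [Matrix.cons_val_zero, Matrix.cons_val_one] at h0 h1
    exact Prod.ext (by rw [h1] at h0; exact add_right_cancel h0) h1
  · refine ⟨(x 0 - c * x 1, x 1), ?_, ?_⟩
    · rw [Finset.mem_filter] at hx ⊢
      refine ⟨Finset.mem_univ _, ?_⟩
      rw [evalEval_model, sub_add_cancel]
      have : ![x 0, x 1] = x := by ext i; fin_cases i <;> rfl
      rw [this, hx.2, mul_zero]
    · ext i; fin_cases i <;> simp

/-! ### Base change and absolute irreducibility -/

/-- `equivMvPolynomial` commutes with base change. [folklore] -/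
theorem map_equivMvPolynomial {L : Type*} [CommRing L] (σ : K →+* L) (p : Polynomial (Polynomial K)) :
    MvPolynomial.map σ (equivMvPolynomial K p) =
      equivMvPolynomial L (p.map (Polynomial.mapRingHom σ)) := by
  have h : (MvPolynomial.map σ).comp
      (equivMvPolynomial K : Polynomial (Polynomial K) →+* MvPolynomial (Fin 2) K) =
      (equivMvPolynomial L : Polynomial (Polynomial L) →+* MvPolynomial (Fin 2) L).comp
        (Polynomial.mapRingHom (Polynomial.mapRingHom σ)) := by
    refine Polynomial.ringHom_ext (fun q ↦ ?_) ?_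
    · refine Polynomial.induction_on' q (fun p r hp hr ↦ by simp only [map_add, hp, hr]) ?_
      intro m r
      rw [← Polynomial.C_mul_X_pow_eq_monomial]
      simp only [RingHom.comp_apply, RingHom.coe_coe, map_mul, map_pow, Polynomial.coe_mapRingHom,
        Polynomial.map_C, Polynomial.map_X, equivMvPolynomial_C_C, equivMvPolynomial_C_X, map_C, map_X]
    · simp only [RingHom.comp_apply, RingHom.coe_coe, Polynomial.coe_mapRingHom, Polynomial.map_X,
        equivMvPolynomial_X, map_X]
  exact RingHom.congr_fun h p

/-- `equivMvPolynomial.symm` commutes with base change. [folklore] -/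
theorem map_equivMvPolynomial_symm {L : Type*} [CommRing L] (σ : K →+* L) (F : MvPolynomial (Fin 2) K) :
    ((equivMvPolynomial K).symm F).map (Polynomial.mapRingHom σ) =
      (equivMvPolynomial L).symm (MvPolynomial.map σ F) := by
  apply (equivMvPolynomial L).injective
  rw [AlgEquiv.apply_symm_apply, ← map_equivMvPolynomial, AlgEquiv.apply_symm_apply]

/-- **The model of an absolutely irreducible `g` is absolutely irreducible**: if the image of `g` over
an extension `L` is irreducible, so is the image of the model (the shear is an algebra automorphism
over `L` and `u⁻¹` is a unit). [folklore] -/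
theorem irreducible_map_model {L : Type*} [Field L] (σ : K →+* L) {u : K} (hu : u ≠ 0)
    (hirr : Irreducible (MvPolynomial.map σ g)) :
    Irreducible (((equivMvPolynomial K).symm
      (C u⁻¹ * MvPolynomial.aeval sv(K, c) g)).map (Polynomial.mapRingHom σ)) := by
  rw [map_equivMvPolynomial_symm, map_mul, map_C, map_shear]
  refine (MulEquiv.irreducible_iff (equivMvPolynomial L).symm).2 ?_
  have hunit : IsUnit (C (σ u⁻¹) : MvPolynomial (Fin 2) L) :=
    (IsUnit.mk0 _ (by rw [map_ne_zero_iff _ σ.injective]; exact inv_ne_zero hu)).map C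
  rw [irreducible_isUnit_mul hunit]
  -- the shear is an algebra automorphism
  let τ : MvPolynomial (Fin 2) L ≃ₐ[L] MvPolynomial (Fin 2) L :=
    AlgEquiv.ofAlgHom (MvPolynomial.aeval sv(L, σ c))
      (MvPolynomial.aeval
        (![MvPolynomial.X 0 - MvPolynomial.C (σ c) * MvPolynomial.X 1, MvPolynomial.X 1] :
          Fin 2 → MvPolynomial (Fin 2) L))
      (by
        refine MvPolynomial.algHom_ext fun i ↦ ?_
        fin_cases i
        · simp only [AlgHom.coe_comp, Function.comp_apply, aeval_X, Fin.zero_eta, Fin.isValue,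
            Matrix.cons_val_zero, map_sub, map_mul, algHom_C, MvPolynomial.algebraMap_eq,
            Matrix.cons_val_one, AlgHom.coe_id, id_eq]
          ring
        · simp)
      (by
        refine MvPolynomial.algHom_ext fun i ↦ ?_
        fin_cases i
        · simp only [AlgHom.coe_comp, Function.comp_apply, aeval_X, Fin.zero_eta, Fin.isValue,
            Matrix.cons_val_zero, map_add, map_mul, algHom_C, MvPolynomial.algebraMap_eq,
            Matrix.cons_val_one, AlgHom.coe_id, id_eq]
          ring
        · simp)
  exact (MulEquiv.irreducible_iff τ).2 hirr

end Model

end Literature.NumberTheory.DiophantineGeometry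

end
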